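import Summits.BirchSwinnertonDyer.BirchSwinnertonDyer.Theorems.ManinLocalTwoThreeHeckeAdCommute
import HarnessLib

/-!
# `T_p` commutes with any transport of the Hecke representatives (σ2 of MEMO-es §25.6, abstract form), and the
# `t`-shift relation on integer matrices

Summit `BirchSwinnertonDyer`, route `ManinLocalTwoThree` (cell bsd-f2-manin), crux C2 `ManinOddAtFour` (stmt-BirchSwinnertonDyer-22967),
line `kato_shift_two` v6, stub 3 (`C₃`-image residual), vertex step E-es-42 `AtkinLehnerStep` of MEMO-es §25.3 (V-b): the lead's
auxiliary cocycle `u ∘ Ad(W) − u` for an ATKIN–LEHNER element `W = diag(1,t)·h` (`h ∈ Γ₀(L′)`, `t ∣ h₀₀`, level `tL′`) must be a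
generalised Hecke eigenvector.  `W ∉ SL₂(ℤ)`, so `heckeU_zero_conj` (conjugation by an element of `SL₂(ℤ)`) does not apply
literally; this file isolates what its proof uses.

* `heckeU_zero_comp_of_transport`: for ANY map `Φ : Γ₀(N) → Γ₀(N)` and any family `ad i ∈ Δ₀ᴺ(p)` ("the transported
  representatives `W βᵢ W⁻¹`") which is free (`ad i = ε · ad i′`, `ε ∈ Γ₀(N)` ⟹ `i = i′`) and transports the permutation
  data at `γ` (`ad i · Φ γ = Φ(γ′ᵢ) · ad (σ_γ i)`), `(T_p (u ∘ Φ))(γ) = (T_p u)(Φ γ)` for every degree-`0` cocycle `u`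
  (via the representative-independence `heckeU_zero_apply_eq_sum_of_reps`).
* the `t`-SHIFT RELATION on `M₂(ℤ)` — `X = A_t Y A_t⁻¹` entrywise, `A_t = diag(t,1)`, written exactly as es's `IsShiftConj t X Y`
  and p1's `shiftRel_*` (which are stated for `SL₂` only): multiplicativity, determinant, uniqueness on both sides for `t ≠ 0`,
  and existence (`t ∣ X₀₁`, resp. `t ∣ Y₁₀`).

No new definitions; nothing about BSD or Manin's conjecture is proved here.

References: G. Shimura (1971) §8.3 (8.3.2) and the remark after it [cite: Shimura1971, §8.3 (8.3.2)]; A. O. L. Atkin, J. Lehner,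
*Hecke operators on `Γ₀(m)`*, Math. Ann. 185 (1970), Lemma 11 (`W_q` commutes with `T_p`, `p ∤ q`); cell memo HOME/MEMO-es.md
§25.3 (V-b), §25.6 σ2; cell INBOX 2026-08-28T04:27:26Z (lead: the `Φ`-currency).
-/

set_option autoImplicit false
set_option linter.dupNamespace false

open scoped MatrixGroups

open CongruenceSubgroup Matrix.SpecialLinearGroup Literature.NumberTheory.EllipticCurves.ModularForms
  Literature.NumberTheory.EllipticCurves.ModularForms.HidaCohomology

namespace Summit.BirchSwinnertonDyer.BirchSwinnertonDyer.Theorems.ManinLocalTwoThree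

section Transport

variable {N p : ℕ} [NeZero p] (hp : p.Prime) {R : Type*} [CommRing R]

/-- **`T_p` commutes with a transport of the representatives.**  Let `Φ : Γ₀(N) → Γ₀(N)` be any map and `ad i ∈ Δ₀ᴺ(p)`
(`i ∈ I_p(N)`) a family with (free) `ad i = ε · ad i′` for some `ε ∈ Γ₀(N)` only if `i = i′`, and (transport at `γ`)
`ad i · Φ γ = Φ(γ′ᵢ) · ad (σ_γ i)` where `βᵢ γ = γ′ᵢ β_{σ_γ i}` are the tree's permutation data.  Then for every degree-`0`
cocycle `u`, `(T_p (u ∘ Φ))(γ) = (T_p u)(Φ γ)`. [cite: Shimura1971, §8.3 (8.3.2)] -/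
theorem heckeU_zero_comp_of_transport (Φ : Gamma0 N → Gamma0 N) (ad : HeckeIdx N p → Matrix (Fin 2) (Fin 2) ℤ)
    (hrep : ∀ i, ad i ∈ Delta0 N (p * 1))
    (hfree : ∀ i i' (ε : Gamma0 N), ad i = gmat ε * ad i' → i = i')
    {u : Gamma0 N → Fin 1 → R} (hu : u ∈ cocycles 0 N R) (γ : Gamma0 N)
    (hmul : ∀ i, ad i * gmat (Φ γ) = gmat (Φ (heckePermElt hp γ i)) * ad (heckePerm hp γ i)) :
    heckeU 0 N R hp (u ∘ Φ) γ = heckeU 0 N R hp u (Φ γ) := by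
  classical
  have hp1 : ¬ (p : ℤ) ∣ 1 := not_intCast_dvd_one hp
  -- `ad i = δᵢ β_{k i}` with `δᵢ ∈ Γ₀(N)`
  have hdec : ∀ i : HeckeIdx N p, ∃ k : HeckeIdx N p, ∃ δ : Gamma0 N, gmat δ * heckeRep p k.1 = ad i := by
    intro i
    obtain ⟨k, ⟨M', hM', hk⟩, -⟩ := existsUnique_mem_delta0_mul_heckeRep hp hp1 (hrep i)
    obtain ⟨δ, hδ, hδk⟩ :=
      (exists_mem_delta0_one_iff (N := N) (fun M ↦ M * heckeRep p k.1 = ad i)).mp ⟨M', hM', hk⟩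
    exact ⟨k, ⟨δ, hδ⟩, hδk⟩
  choose k δ hδ using hdec
  -- `k` is injective by freeness
  have hk_inj : Function.Injective k := by
    intro i i' hii'
    refine hfree i i' (δ i * (δ i')⁻¹) ?_
    have h1 := hδ i
    have h2 := hδ i'
    rw [hii'] at h1
    rw [← h1, ← h2]
    simp only [gmat, Subgroup.coe_mul, Subgroup.coe_inv, Matrix.SpecialLinearGroup.coe_mul, Matrix.mul_assoc]
    rw [← Matrix.mul_assoc ((((δ i' : Gamma0 N) : SL(2, ℤ))⁻¹ : SL(2, ℤ)) : Matrix (Fin 2) (Fin 2) ℤ),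
      coe_inv_mul_coe, Matrix.one_mul]
  let π : HeckeIdx N p ≃ HeckeIdx N p := Equiv.ofBijective k (Finite.injective_iff_bijective.mp hk_inj)
  have hdata : ∀ i, gmat (δ i) * heckeRep p (π i).1 * gmat (Φ γ) =
      gmat (Φ (heckePermElt hp γ i)) * (gmat (δ (heckePerm hp γ i)) * heckeRep p (π (heckePerm hp γ i)).1) := by
    intro i
    show gmat (δ i) * heckeRep p (k i).1 * gmat (Φ γ) =
      gmat (Φ (heckePermElt hp γ i)) * (gmat (δ (heckePerm hp γ i)) * heckeRep p (k _).1)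
    rw [hδ i, hδ (heckePerm hp γ i)]
    exact hmul i
  rw [heckeU_zero_apply_eq_sum_of_reps hp hu (Φ γ) π δ (heckePerm hp γ) (fun i ↦ Φ (heckePermElt hp γ i)) hdata,
    heckeU_apply]
  simp only [act_zero_eq_id, LinearMap.id_apply]
  rfl

end Transport

/-! ### The `t`-shift relation `X = diag(t,1) Y diag(t,1)⁻¹` on integer matrices, written on entries -/

section ShiftRelMat

variable (t : ℤ)

/-- The shift relation on `M₂(ℤ)` is multiplicative. [folklore] -/
theorem shiftRelMat_mul {X Y X' Y' : Matrix (Fin 2) (Fin 2) ℤ}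
    (hXY : X 0 0 = Y 0 0 ∧ X 0 1 = t * Y 0 1 ∧ t * X 1 0 = Y 1 0 ∧ X 1 1 = Y 1 1)
    (hXY' : X' 0 0 = Y' 0 0 ∧ X' 0 1 = t * Y' 0 1 ∧ t * X' 1 0 = Y' 1 0 ∧ X' 1 1 = Y' 1 1) :
    (X * X') 0 0 = (Y * Y') 0 0 ∧ (X * X') 0 1 = t * (Y * Y') 0 1 ∧ t * (X * X') 1 0 = (Y * Y') 1 0 ∧
      (X * X') 1 1 = (Y * Y') 1 1 := by
  obtain ⟨h1, h2, h3, h4⟩ := hXY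
  obtain ⟨k1, k2, k3, k4⟩ := hXY'
  simp only [Matrix.mul_apply, Fin.sum_univ_two]
  refine ⟨?_, ?_, ?_, ?_⟩
  · linear_combination (X' 0 0) * h1 + (Y 0 0) * k1 + (X' 1 0) * h2 + (Y 0 1) * k3
  · linear_combination (X' 0 1) * h1 + (Y 0 0) * k2 + (X' 1 1) * h2 + t * (Y 0 1) * k4
  · linear_combination (X' 0 0) * h3 + (Y 1 0) * k1 + t * (X' 1 0) * h4 + (Y 1 1) * k3
  · linear_combination (X 1 0) * k2 + (Y' 0 1) * h3 + (X' 1 1) * h4 + (Y 1 1) * k4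

/-- Shift-related matrices have the same determinant. [folklore] -/
theorem shiftRelMat_det {X Y : Matrix (Fin 2) (Fin 2) ℤ}
    (hXY : X 0 0 = Y 0 0 ∧ X 0 1 = t * Y 0 1 ∧ t * X 1 0 = Y 1 0 ∧ X 1 1 = Y 1 1) : X.det = Y.det := by
  obtain ⟨h1, h2, h3, h4⟩ := hXY
  rw [Matrix.det_fin_two, Matrix.det_fin_two]
  linear_combination (Y 1 1) * h1 + (X 0 0) * h4 - (X 1 0) * h2 - (Y 0 1) * h3

/-- For `t ≠ 0` the matrix of which `X` is the shift is unique. [folklore] -/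
theorem shiftRelMat_right_unique (ht : t ≠ 0) {X Y Y' : Matrix (Fin 2) (Fin 2) ℤ}
    (hXY : X 0 0 = Y 0 0 ∧ X 0 1 = t * Y 0 1 ∧ t * X 1 0 = Y 1 0 ∧ X 1 1 = Y 1 1)
    (hXY' : X 0 0 = Y' 0 0 ∧ X 0 1 = t * Y' 0 1 ∧ t * X 1 0 = Y' 1 0 ∧ X 1 1 = Y' 1 1) : Y = Y' := by
  obtain ⟨h1, h2, h3, h4⟩ := hXY
  obtain ⟨k1, k2, k3, k4⟩ := hXY'
  ext i j
  fin_cases i <;> fin_cases j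
  · exact h1.symm.trans k1
  · exact mul_left_cancel₀ ht (h2.symm.trans k2)
  · exact h3.symm.trans k3
  · exact h4.symm.trans k4

/-- For `t ≠ 0` the shift of a matrix is unique. [folklore] -/
theorem shiftRelMat_left_unique (ht : t ≠ 0) {X X' Y : Matrix (Fin 2) (Fin 2) ℤ}
    (hXY : X 0 0 = Y 0 0 ∧ X 0 1 = t * Y 0 1 ∧ t * X 1 0 = Y 1 0 ∧ X 1 1 = Y 1 1)
    (hX'Y : X' 0 0 = Y 0 0 ∧ X' 0 1 = t * Y 0 1 ∧ t * X' 1 0 = Y 1 0 ∧ X' 1 1 = Y 1 1) : X = X' := by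
  obtain ⟨h1, h2, h3, h4⟩ := hXY
  obtain ⟨k1, k2, k3, k4⟩ := hX'Y
  ext i j
  fin_cases i <;> fin_cases j
  · exact h1.trans k1.symm
  · exact h2.trans k2.symm
  · exact mul_left_cancel₀ ht (h3.trans k3.symm)
  · exact h4.trans k4.symm

/-- **Shifting down**: if `t ∣ X₀₁` then `X` is the shift of `(X₀₀, X₀₁/t; tX₁₀, X₁₁)`. [folklore] -/
theorem exists_shiftRelMat_down {X : Matrix (Fin 2) (Fin 2) ℤ} (h : t ∣ X 0 1) :
    ∃ Y : Matrix (Fin 2) (Fin 2) ℤ, X 0 0 = Y 0 0 ∧ X 0 1 = t * Y 0 1 ∧ t * X 1 0 = Y 1 0 ∧ X 1 1 = Y 1 1 := by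
  obtain ⟨b, hb⟩ := h
  exact ⟨!![X 0 0, b; t * X 1 0, X 1 1], rfl, hb, rfl, rfl⟩

/-- **Shifting up**: if `t ∣ Y₁₀` then `(Y₀₀, tY₀₁; Y₁₀/t, Y₁₁)` is the shift of `Y`. [folklore] -/
theorem exists_shiftRelMat_up {Y : Matrix (Fin 2) (Fin 2) ℤ} (h : t ∣ Y 1 0) :
    ∃ X : Matrix (Fin 2) (Fin 2) ℤ, X 0 0 = Y 0 0 ∧ X 0 1 = t * Y 0 1 ∧ t * X 1 0 = Y 1 0 ∧ X 1 1 = Y 1 1 := by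
  obtain ⟨c, hc⟩ := h
  exact ⟨!![Y 0 0, t * Y 0 1; c, Y 1 1], rfl, rfl, hc.symm, rfl⟩

end ShiftRelMat

end Summit.BirchSwinnertonDyer.BirchSwinnertonDyer.Theorems.ManinLocalTwoThree
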